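import Summits.Ventures.Crystal3D.Theorems.StickyWulffConstantPolycrystalWulffBoundRungTwinFreeTwoClasses
import Summits.Ventures.Crystal3D.Theorems.StickyWulffConstantPolycrystalWulffBoundSubfamilyPerimeter

/-!
# `PolycrystalWulffBound`, line `PolyDensity`: the DELETION MOVE (induction step of CJ-P)

Route `StickyWulffConstant` of the venture `Summits/Ventures/Crystal3D`, crux `PolycrystalWulffBound`
(item `stmt-Ventures-19482`), second prover lane (poly-p2, gen 4).  Second inductive move of the
middle-band programme (HOME/poly-p2/MIDDLE-BAND.md, MIDDLE-BAND-g4.md; CJ-P of ROUTE §82): DELETE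
every grain of a union `S` of lattice classes (replace it by `∅`, re-frame it with the frame of a kept
grain `g₀`, and reset its wall data to the generic values `c = 1`, `m = 0`).  In the crux's `let`
vocabulary (`delete_move`):

* the deleted data `(G', A', c', m')` is an admissible TWIN-FREE polyhedral texture (`Tex`, `Poly`,
  `TF`) whose lattice classes are the old ones off `S`, and
  `|⋃ G'| + Σ_{f ∈ S} |G f| = |⋃ G|`;
* `En(G', A', c', m') + Fr_S − (√5 − 1)·X + A_int ≤ En(G, A, c, m)`, where `Fr_S` is the free energy
  of the grains of `S`, `X` the Euclidean area of the interfaces between `S` and its complement (they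
  become free boundary of the kept grains, charged `≤ √5`, and were walls charged `≥ 1`) and `A_int`
  the Euclidean area of the walls between grains of `S` in DIFFERENT classes.

Combined with a rung for fewer classes applied to `(G', A', c', m')` this is the LP line
«delete S: En ≥ κ′·(Vol − v_S)^{2/3} + Fr_S − (√5 − 1)·A(S, Sᶜ) + A_int(S)».
WHAT THIS IS NOT: the recolouring move (`recolour_move`); a rung; F-C1 not moved.
-/

noncomputable section

open scoped BigOperators InnerProductSpace ENNReal
open MeasureTheory Filter

namespace Summit.Ventures.Crystal3D.Cruxes.PolycrystalWulffBound.PolyDensity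

open Summit.Ventures.Crystal3D.Theorems
open Summit.Ventures.Crystal3D.Cruxes.TextureLiminf.TexShadow (per polytope E3)
open Literature.MathematicalPhysics.StatisticalMechanics (perimeter)

/-- **Deletion move.**  See the module docstring.  `cls` is any labelling of the grains with
`cls f = cls g ↔ A f '' Λ = A g '' Λ` (the lattice classes), `S` a union of classes, `g₀ ∉ S`. -/
theorem delete_move :
    let Λ : Set (EuclideanSpace ℝ (Fin 3)) := Literature.MathematicalPhysics.StatisticalMechanics.fccStacking 1 (Real.sqrt (2 / 3));
    let Brl : (ℤ → ℤ) → Set (EuclideanSpace ℝ (Fin 3)) := Literature.MathematicalPhysics.StatisticalMechanics.barlowStacking 1 (Real.sqrt (2 / 3));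
    let Ax : EuclideanSpace ℝ (Fin 3) → (EuclideanSpace ℝ (Fin 3) ≃ₗᵢ[ℝ] EuclideanSpace ℝ (Fin 3)) → (EuclideanSpace ℝ (Fin 3) ≃ₗᵢ[ℝ] EuclideanSpace ℝ (Fin 3)) → Prop := fun m A B => ∃ (L : EuclideanSpace ℝ (Fin 3) ≃ₗᵢ[ℝ] EuclideanSpace ℝ (Fin 3)) (s₁ s₂ : EuclideanSpace ℝ (Fin 3)) (σ σ' : ℤ → ℤ), Literature.MathematicalPhysics.StatisticalMechanics.IsHaggSeq σ ∧ Literature.MathematicalPhysics.StatisticalMechanics.IsHaggSeq σ' ∧ L (EuclideanSpace.single (2 : Fin 3) (1 : ℝ)) = m ∧ A '' Λ ⊆ (fun q => L q + s₁) '' Brl σ ∧ B '' Λ ⊆ (fun q => L q + s₂) '' Brl σ';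
    let CoAx : (EuclideanSpace ℝ (Fin 3) ≃ₗᵢ[ℝ] EuclideanSpace ℝ (Fin 3)) → (EuclideanSpace ℝ (Fin 3) ≃ₗᵢ[ℝ] EuclideanSpace ℝ (Fin 3)) → Prop := fun A B => ∃ m, Ax m A B;
    let Φ : EuclideanSpace ℝ (Fin 3) → ℝ := fun ν => Real.sqrt 2 / 4 * ∑ᶠ w ∈ {w ∈ Λ | ‖w‖ = 1}, |⟪w, ν⟫_ℝ|;
    let Per : Set (EuclideanSpace ℝ (Fin 3)) → Set (EuclideanSpace ℝ (Fin 3)) → ℝ := fun K S => (⨆ (ξ : EuclideanSpace ℝ (Fin 3) → EuclideanSpace ℝ (Fin 3)) (_ : ContDiff ℝ 1 ξ ∧ HasCompactSupport ξ ∧ ∀ z, ξ z ∈ K), ENNReal.ofReal (∫ z in S, Literature.MathematicalPhysics.StatisticalMechanics.fieldDivergence ξ z)).toReal;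
    let ι : Set (EuclideanSpace ℝ (Fin 3)) → Set (EuclideanSpace ℝ (Fin 3)) → Set (EuclideanSpace ℝ (Fin 3)) → ℝ := fun K S₁ S₂ => (Per K S₁ + Per K S₂ - Per K (S₁ ∪ S₂)) / 2;
    let W : (EuclideanSpace ℝ (Fin 3) ≃ₗᵢ[ℝ] EuclideanSpace ℝ (Fin 3)) → Set (EuclideanSpace ℝ (Fin 3)) := fun A => {y | ∀ ν : EuclideanSpace ℝ (Fin 3), ⟪y, ν⟫_ℝ ≤ Φ (A.symm ν)};
    let Dsc : EuclideanSpace ℝ (Fin 3) → Set (EuclideanSpace ℝ (Fin 3)) := fun m => {y | ‖y‖ ≤ 1 ∧ ⟪y, m⟫_ℝ = 0};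
    let Tex : (n : ℕ) → (Fin n → Set (EuclideanSpace ℝ (Fin 3))) → (Fin n → (EuclideanSpace ℝ (Fin 3) ≃ₗᵢ[ℝ] EuclideanSpace ℝ (Fin 3))) → (Fin n → Fin n → ℝ) → (Fin n → Fin n → EuclideanSpace ℝ (Fin 3)) → Prop := fun n G A c m => (∀ f : Fin n, Literature.MathematicalPhysics.StatisticalMechanics.HasFinitePerimeter (G f) ∧ volume (G f) < ⊤) ∧ (∀ f g, f ≠ g → Disjoint (G f) (G g)) ∧ (∀ f g, f ≠ g → 0 ≤ c f g) ∧ (∀ f g, f ≠ g → ¬ CoAx (A f) (A g) → m f g = 0 ∧ 1 ≤ c f g) ∧ (∀ f g, f ≠ g → CoAx (A f) (A g) → A f '' Λ ≠ A g '' Λ → Ax (m f g) (A f) (A g) ∧ 1 / 2 ≤ c f g);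
    let En : (n : ℕ) → (Fin n → Set (EuclideanSpace ℝ (Fin 3))) → (Fin n → (EuclideanSpace ℝ (Fin 3) ≃ₗᵢ[ℝ] EuclideanSpace ℝ (Fin 3))) → (Fin n → Fin n → ℝ) → (Fin n → Fin n → EuclideanSpace ℝ (Fin 3)) → ℝ := fun n G A c m => ∑ f : Fin n, Per (W (A f)) (G f) - ∑ f, ∑ g, (if f = g then 0 else ι (W (A f)) (G f) (G g)) + ∑ f, ∑ g, (if f = g then 0 else c f g / 2 * ι (Dsc (m f g)) (G f) (G g));
    let Poly : Set (EuclideanSpace ℝ (Fin 3)) → Prop := fun S => ∃ (k : ℕ) (H : Fin k → Finset ((EuclideanSpace ℝ (Fin 3)) × ℝ)), S = ⋃ i, ⋂ p ∈ H i, {x | ⟪p.1, x⟫_ℝ < p.2};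
    let TF : (n : ℕ) → (Fin n → (EuclideanSpace ℝ (Fin 3) ≃ₗᵢ[ℝ] EuclideanSpace ℝ (Fin 3))) → Prop := fun n A => ∀ f g : Fin n, f ≠ g → CoAx (A f) (A g) → A f '' Λ = A g '' Λ;
    ∀ (n : ℕ) (G : Fin n → Set (EuclideanSpace ℝ (Fin 3))) (A : Fin n → (EuclideanSpace ℝ (Fin 3) ≃ₗᵢ[ℝ] EuclideanSpace ℝ (Fin 3))) (c : Fin n → Fin n → ℝ) (m : Fin n → Fin n → EuclideanSpace ℝ (Fin 3))
      (β : Type) [DecidableEq β] (cls : Fin n → β) (S : Finset (Fin n)) (g₀ : Fin n),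
      Tex n G A c m → (∀ f, Poly (G f)) → TF n A →
      (∀ f g : Fin n, cls f = cls g ↔ A f '' Λ = A g '' Λ) → (∀ f g : Fin n, cls f = cls g → f ∈ S → g ∈ S) → g₀ ∉ S →
      let G' : Fin n → Set (EuclideanSpace ℝ (Fin 3)) := fun f => if f ∈ S then ∅ else G f;
      let A' : Fin n → (EuclideanSpace ℝ (Fin 3) ≃ₗᵢ[ℝ] EuclideanSpace ℝ (Fin 3)) := fun f => if f ∈ S then A g₀ else A f;
      let c' : Fin n → Fin n → ℝ := fun f g => if f ∈ S ∨ g ∈ S then 1 else c f g;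
      let m' : Fin n → Fin n → EuclideanSpace ℝ (Fin 3) := fun f g => if f ∈ S ∨ g ∈ S then 0 else m f g;
      Tex n G' A' c' m' ∧ (∀ f, Poly (G' f)) ∧ TF n A' ∧
      (volume (⋃ f, G' f)).toReal + (∑ f ∈ S, (volume (G f)).toReal) = (volume (⋃ f, G f)).toReal ∧
      En n G' A' c' m'
        + (∑ f ∈ S, (Per (W (A f)) (G f) - ∑ g, (if f = g then 0 else ι (W (A f)) (G f) (G g))))
        - (Real.sqrt 5 - 1) * (∑ f, ∑ g, (if f ∉ S ∧ g ∈ S then ι (Metric.closedBall (0 : EuclideanSpace ℝ (Fin 3)) 1) (G f) (G g) else 0))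
        + (∑ f, ∑ g, (if f ≠ g ∧ f ∈ S ∧ g ∈ S ∧ cls f ≠ cls g
            then ι (Metric.closedBall (0 : EuclideanSpace ℝ (Fin 3)) 1) (G f) (G g) / 2 else 0))
        ≤ En n G A c m := by
  intro Λ Brl Ax CoAx Φ Per ι W Dsc Tex En Poly TF n G A c m β _ cls S g₀ hTex hPoly hTF hcls hS hg₀ G' A' c' m'
  classical
  obtain ⟨hfin, hdisj, hc0, hgen, hco⟩ := hTex
  have hvol : ∀ f, volume (G f) < ⊤ := fun f => (hfin f).2
  -- co-axiality of frames with the same lattice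
  have hcoax : ∀ B B' : EuclideanSpace ℝ (Fin 3) ≃ₗᵢ[ℝ] EuclideanSpace ℝ (Fin 3),
      B '' Λ = B' '' Λ → CoAx B B' := by
    intro B B' hBB'
    refine ⟨B (EuclideanSpace.single (2 : Fin 3) (1 : ℝ)), B, 0, 0,
      Literature.MathematicalPhysics.StatisticalMechanics.constHagg,
      Literature.MathematicalPhysics.StatisticalMechanics.constHagg,
      Literature.MathematicalPhysics.StatisticalMechanics.isHaggSeq_const,
      Literature.MathematicalPhysics.StatisticalMechanics.isHaggSeq_const, rfl, ?_, ?_⟩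
    · show B '' Λ ⊆ (fun q => B q + 0) '' Λ
      simp
    · show B' '' Λ ⊆ (fun q => B q + 0) '' Λ
      rw [← hBB']; simp
  have hwall : ∀ f g, cls f ≠ cls g → m f g = 0 ∧ 1 ≤ c f g := by
    intro f g hne
    have hne' : A f '' Λ ≠ A g '' Λ := fun h => hne ((hcls f g).2 h)
    have hfg : f ≠ g := fun h => hne (h ▸ rfl)
    exact hgen f g hfg (fun hcx => hne' (hTF f g hfg hcx))
  have hclsS : ∀ f g, f ∈ S → g ∉ S → cls f ≠ cls g := fun f g hf hg h => hg (hS f g h hf)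
  -- the frame map
  set π : Fin n → Fin n := fun f => if f ∈ S then g₀ else f with hπ
  have hA' : ∀ f, A' f = A (π f) := by
    intro f; by_cases h : f ∈ S <;> simp [A', hπ, h]
  -- the new grains
  have hG'S : ∀ f, f ∈ S → G' f = ∅ := fun f hf => by simp [G', hf]
  have hG'N : ∀ f, f ∉ S → G' f = G f := fun f hf => by simp [G', hf]
  -- Tex, Poly, TF for the deleted texture
  have hTex' : Tex n G' A' c' m' := by
    refine ⟨?_, ?_, ?_, ?_, ?_⟩
    · intro f
      by_cases hf : f ∈ S
      · rw [hG'S f hf]; exact ⟨hasFinitePerimeter_empty, by simp⟩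
      · rw [hG'N f hf]; exact hfin f
    · intro f g hfg
      by_cases hf : f ∈ S
      · rw [hG'S f hf]; exact Set.empty_disjoint _
      · by_cases hg : g ∈ S
        · rw [hG'S g hg]; exact Set.disjoint_empty _
        · rw [hG'N f hf, hG'N g hg]; exact hdisj f g hfg
    · intro f g hfg
      show 0 ≤ (if f ∈ S ∨ g ∈ S then 1 else c f g)
      split_ifs
      · exact zero_le_one
      · exact hc0 f g hfg
    · intro f g hfg hncx
      show (if f ∈ S ∨ g ∈ S then (0 : EuclideanSpace ℝ (Fin 3)) else m f g) = 0 ∧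
        1 ≤ (if f ∈ S ∨ g ∈ S then 1 else c f g)
      by_cases h : f ∈ S ∨ g ∈ S
      · rw [if_pos h, if_pos h]; exact ⟨rfl, le_rfl⟩
      · rw [if_neg h, if_neg h]
        push Not at h
        have e1 : A' f = A f := by simp [A', h.1]
        have e2 : A' g = A g := by simp [A', h.2]
        rw [e1, e2] at hncx
        exact hgen f g hfg hncx
    · intro f g hfg hcx hne
      by_cases h : f ∈ S ∨ g ∈ S
      · exfalso
        apply hne
        rw [hA' f, hA' g] at hcx ⊢
        by_cases hπfg : π f = π g
        · rw [hπfg]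
        · exact hTF _ _ hπfg hcx
      · push Not at h
        have e1 : A' f = A f := by simp [A', h.1]
        have e2 : A' g = A g := by simp [A', h.2]
        show Ax (if f ∈ S ∨ g ∈ S then (0 : EuclideanSpace ℝ (Fin 3)) else m f g) (A' f) (A' g) ∧
          1 / 2 ≤ (if f ∈ S ∨ g ∈ S then 1 else c f g)
        rw [if_neg (not_or.2 ⟨h.1, h.2⟩), if_neg (not_or.2 ⟨h.1, h.2⟩), e1, e2]
        rw [e1, e2] at hcx hne
        exact hco f g hfg hcx hne
  have hPoly' : ∀ f, Poly (G' f) := by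
    intro f
    by_cases hf : f ∈ S
    · rw [hG'S f hf]; exact empty_eq_iUnion_polytope
    · rw [hG'N f hf]; exact hPoly f
  have hTF' : TF n A' := by
    intro f g hfg hcx
    rw [hA' f, hA' g] at hcx ⊢
    by_cases hπfg : π f = π g
    · rw [hπfg]
    · exact hTF _ _ hπfg hcx
  -- volumes
  have hVol : (volume (⋃ f, G' f)).toReal + (∑ f ∈ S, (volume (G f)).toReal) =
      (volume (⋃ f, G f)).toReal := by
    have hU : (⋃ f, G' f) = ⋃ f ∈ (Finset.univ \ S), G f := by
      rw [← iUnion_ite_mem_eq_biUnion G (Finset.univ \ S)]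
      congr 1; ext f x
      simp [G', Finset.mem_sdiff]
    rw [hU, (subfamily_union_facts G hfin hdisj _).2.2.2, (texture_union_facts G hfin hdisj).2.2.2,
      Finset.sum_sdiff (Finset.subset_univ S)]
  refine ⟨hTex', hPoly', hTF', hVol, ?_⟩
  -- bodies
  have hDsc0 : Dsc 0 = Metric.closedBall (0 : E3) 1 := by
    show {y : E3 | ‖y‖ ≤ 1 ∧ ⟪y, (0 : E3)⟫_ℝ = 0} = Metric.closedBall 0 1
    ext y; simp [inner_zero_right]
  have hBc : IsCompact (Metric.closedBall (0 : E3) 1) := isCompact_closedBall 0 1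
  have hBv : Convex ℝ (Metric.closedBall (0 : E3) 1) := convex_closedBall 0 1
  have hB0 : (0 : E3) ∈ Metric.closedBall (0 : E3) 1 := Metric.mem_closedBall_self zero_le_one
  have hB5c : IsCompact (Metric.closedBall (0 : E3) (Real.sqrt 5)) := isCompact_closedBall 0 _
  have hB5v : Convex ℝ (Metric.closedBall (0 : E3) (Real.sqrt 5)) := convex_closedBall 0 _
  have hB50 : (0 : E3) ∈ Metric.closedBall (0 : E3) (Real.sqrt 5) :=
    Metric.mem_closedBall_self (Real.sqrt_nonneg 5)
  have hDc : ∀ v : E3, IsCompact (Dsc v) := fun v =>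
    Metric.isCompact_of_isClosed_isBounded
      ((isClosed_le continuous_norm continuous_const).inter
        (isClosed_eq (continuous_id.inner continuous_const) continuous_const))
      (Metric.isBounded_closedBall.subset (cruxDisc_subset_closedBall v))
  have hWc : ∀ B : E3 ≃ₗᵢ[ℝ] E3, IsCompact (W B) := fun B => isCompact_cruxWulffBody B
  have hWv : ∀ B : E3 ≃ₗᵢ[ℝ] E3, Convex ℝ (W B) := fun B => convex_cruxWulffBody B
  have hW0 : ∀ B : E3 ≃ₗᵢ[ℝ] E3, (0 : E3) ∈ W B := fun B => zero_mem_cruxWulffBody B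
  have hW5 : ∀ B : E3 ≃ₗᵢ[ℝ] E3, W B ⊆ Metric.closedBall (0 : E3) (Real.sqrt 5) := fun B =>
    cruxWulffBody_subset_closedBall B
  have hperB : ∀ T : Set E3, per (Metric.closedBall (0 : E3) 1) T = (perimeter T).toReal := fun T => by
    rw [per_closedBall_eq_mul_perimeter one_pos T, one_mul]
  have hperB5 : ∀ T : Set E3, per (Metric.closedBall (0 : E3) (Real.sqrt 5)) T =
      Real.sqrt 5 * (perimeter T).toReal := fun T =>
    per_closedBall_eq_mul_perimeter (Real.sqrt_pos.2 (by norm_num)) T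
  -- kernels
  set ιK : Fin n → Fin n → ℝ := fun f g => if f = g then 0 else ι (W (A f)) (G f) (G g) with hιK
  set ιB : Fin n → Fin n → ℝ := fun f g =>
    if f = g then 0 else ι (Metric.closedBall (0 : E3) 1) (G f) (G g) with hιB
  set w : Fin n → Fin n → ℝ := fun f g =>
    if f = g then 0 else c f g / 2 * ι (Dsc (m f g)) (G f) (G g) with hw
  have hιB_symm : ∀ f g, ιB f g = ιB g f := fun f g => iota_kernel_symm _ G f g
  have hιB_nn : ∀ f g, 0 ≤ ιB f g := by
    intro f g
    by_cases hfg : f = g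
    · simp [hιB, hfg]
    · simp only [hιB, hfg, if_false]
      exact div_nonneg (iota_nonneg_of_poly G hPoly hvol hdisj hBc hBv hB0 hfg) zero_le_two
  obtain ⟨k, H, ν, Sc, SX, hcross, -, -⟩ := exists_exterior_crossSums G hPoly hvol hdisj
  have hιK_le : ∀ f g, ιK f g ≤ Real.sqrt 5 * ιB f g := by
    intro f g
    by_cases hfg : f = g
    · simp [hιK, hιB, hfg]
    simp only [hιK, hιB, hfg, if_false]
    have h1 := hcross (W (A f)) (hWc _) (hWv _) (hW0 _) f g hfg
    have h2 := hcross (Metric.closedBall (0 : E3) (Real.sqrt 5)) hB5c hB5v hB50 f g hfg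
    have hmono := crossSum_mono (hW5 (A f)) Metric.isBounded_closedBall ⟨0, hW0 _⟩ H ν (Sc f) (Sc g)
    rw [← h1, ← h2, hperB5, hperB5, hperB5] at hmono
    show (per (W (A f)) (G f) + per (W (A f)) (G g) - per (W (A f)) (G f ∪ G g)) / 2 ≤
      Real.sqrt 5 * ((per (Metric.closedBall (0 : E3) 1) (G f) + per (Metric.closedBall (0 : E3) 1) (G g) -
        per (Metric.closedBall (0 : E3) 1) (G f ∪ G g)) / 2)
    rw [hperB, hperB, hperB]
    linarith
  have hw_nn : ∀ f g, 0 ≤ w f g := by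
    intro f g
    by_cases hfg : f = g
    · simp [hw, hfg]
    · simp only [hw, hfg, if_false]
      refine mul_nonneg (div_nonneg (hc0 f g hfg) zero_le_two) ?_
      show 0 ≤ (per (Dsc (m f g)) (G f) + per (Dsc (m f g)) (G g) - per (Dsc (m f g)) (G f ∪ G g)) / 2
      exact div_nonneg (iota_nonneg_of_poly G hPoly hvol hdisj (hDc (m f g)) (convex_cruxDisc (m f g))
        (zero_mem_cruxDisc (m f g)) hfg) zero_le_two
  have hw_ge : ∀ f g, cls f ≠ cls g → ιB f g / 2 ≤ w f g := by
    intro f g hne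
    have hfg : f ≠ g := fun h => hne (h ▸ rfl)
    obtain ⟨hm, hc1⟩ := hwall f g hne
    simp only [hw, hιB, hfg, if_false]
    rw [hm, hDsc0]
    have := hιB_nn f g
    simp only [hιB, hfg, if_false] at this
    nlinarith
  -- the new texture's terms
  have hP' : ∀ f, Per (W (A' f)) (G' f) = if f ∈ S then 0 else Per (W (A f)) (G f) := by
    intro f
    by_cases hf : f ∈ S
    · rw [if_pos hf, hG'S f hf]; exact per_empty _
    · rw [if_neg hf, hG'N f hf]; simp [A', hf]
  have hι' : ∀ f g, (if f = g then 0 else ι (W (A' f)) (G' f) (G' g)) =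
      if f ∈ S ∨ g ∈ S then 0 else ιK f g := by
    intro f g
    by_cases hfg : f = g
    · simp [hιK, hfg]
    rw [if_neg hfg]
    by_cases hf : f ∈ S
    · rw [if_pos (Or.inl hf), hG'S f hf]
      show (per (W (A' f)) ∅ + per (W (A' f)) (G' g) - per (W (A' f)) (∅ ∪ G' g)) / 2 = 0
      rw [iota_empty_left, zero_div]
    · by_cases hg : g ∈ S
      · rw [if_pos (Or.inr hg), hG'S g hg]
        show (per (W (A' f)) (G' f) + per (W (A' f)) ∅ - per (W (A' f)) (G' f ∪ ∅)) / 2 = 0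
        rw [iota_empty_right, zero_div]
      · rw [if_neg (not_or.2 ⟨hf, hg⟩), hG'N f hf, hG'N g hg]
        simp [hιK, hfg, A', hf]
  have hw' : ∀ f g, (if f = g then 0 else c' f g / 2 * ι (Dsc (m' f g)) (G' f) (G' g)) =
      if f ∈ S ∨ g ∈ S then 0 else w f g := by
    intro f g
    by_cases hfg : f = g
    · simp [hw, hfg]
    rw [if_neg hfg]
    by_cases hf : f ∈ S
    · rw [if_pos (Or.inl hf), hG'S f hf]
      show c' f g / 2 * ((per (Dsc (m' f g)) ∅ + per (Dsc (m' f g)) (G' g) - per (Dsc (m' f g)) (∅ ∪ G' g)) / 2) = 0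
      rw [iota_empty_left, zero_div, mul_zero]
    · by_cases hg : g ∈ S
      · rw [if_pos (Or.inr hg), hG'S g hg]
        show c' f g / 2 * ((per (Dsc (m' f g)) (G' f) + per (Dsc (m' f g)) ∅ - per (Dsc (m' f g)) (G' f ∪ ∅)) / 2) = 0
        rw [iota_empty_right, zero_div, mul_zero]
      · rw [if_neg (not_or.2 ⟨hf, hg⟩), hG'N f hf, hG'N g hg]
        simp [hw, hfg, c', m', hf, hg]
  -- the symmetrised pairwise inequality
  set D : Fin n → Fin n → ℝ := fun f g =>
    (if f ∈ S ∨ g ∈ S then w f g else 0) + (Real.sqrt 5 - 1) * (if f ∉ S ∧ g ∈ S then ιB f g else 0)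
      - (if f ∉ S ∧ g ∈ S then ιK f g else 0)
      - (if f ≠ g ∧ f ∈ S ∧ g ∈ S ∧ cls f ≠ cls g then ιB f g / 2 else 0) with hD
  have hpair : ∀ f g, 0 ≤ D f g + D g f := by
    intro f g
    have h5 : (1 : ℝ) ≤ Real.sqrt 5 := by
      rw [show (1 : ℝ) = Real.sqrt 1 by simp]; exact Real.sqrt_le_sqrt (by norm_num)
    by_cases hfg : f = g
    · subst hfg
      have hwff : w f f = 0 := by simp [hw]
      have hDff : D f f = 0 := by
        simp only [hD, hwff, ne_eq, not_true_eq_false, false_and, if_false, sub_zero]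
        by_cases hf : f ∈ S <;> simp [hf]
      rw [hDff, add_zero]
    by_cases hf : f ∈ S <;> by_cases hg : g ∈ S
    · -- both deleted
      simp only [hD, hf, hg, or_true, if_true, not_true_eq_false, false_and, if_false,
        mul_zero, add_zero, sub_zero, ne_eq, hfg, Ne.symm hfg, not_false_eq_true, true_and]
      by_cases hc : cls f = cls g
      · rw [if_neg (not_not.2 hc), if_neg (not_not.2 hc.symm)]
        linarith [hw_nn f g, hw_nn g f]
      · rw [if_pos hc, if_pos (Ne.symm hc)]
        linarith [hw_ge f g hc, hw_ge g f (Ne.symm hc), hιB_symm f g]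
    · -- f deleted, g kept
      simp only [hD, hf, hg, true_or, or_true, if_true, not_true_eq_false, false_and, if_false,
        and_false, mul_zero, add_zero, sub_zero, not_false_eq_true, true_and, and_true, ne_eq]
      have := hw_ge f g (hclsS f g hf hg)
      have := hw_ge g f (Ne.symm (hclsS f g hf hg))
      have := hιK_le g f
      have := hιB_symm f g
      linarith [hιB_nn f g]
    · -- f kept, g deleted
      simp only [hD, hf, hg, true_or, or_true, if_true, not_true_eq_false, false_and, if_false,
        and_false, mul_zero, add_zero, sub_zero, not_false_eq_true, true_and, and_true, ne_eq]
      have := hw_ge f g (Ne.symm (hclsS g f hg hf))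
      have := hw_ge g f (hclsS g f hg hf)
      have := hιK_le f g
      have := hιB_symm f g
      linarith [hιB_nn f g]
    · simp only [hD, hf, hg, false_or, if_false, and_false, false_and, mul_zero, add_zero, sub_zero,
        not_false_eq_true]
      norm_num
  have hDsum : 0 ≤ ∑ f, ∑ g, D f g := by
    have h2 : ∑ f, ∑ g, D f g + ∑ f, ∑ g, D f g = ∑ f, ∑ g, (D f g + D g f) := by
      conv_lhs => rw [show (∑ f, ∑ g, D f g) + ∑ f, ∑ g, D f g =
        (∑ f, ∑ g, D f g) + ∑ g, ∑ f, D f g by rw [Finset.sum_comm]]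
      rw [← Finset.sum_add_distrib]
      refine Finset.sum_congr rfl fun f _ => ?_
      rw [← Finset.sum_add_distrib]
    have h3 : 0 ≤ ∑ f, ∑ g, (D f g + D g f) :=
      Finset.sum_nonneg fun f _ => Finset.sum_nonneg fun g _ => hpair f g
    linarith
  -- assemble
  have hEn : En n G A c m = (∑ f, Per (W (A f)) (G f)) - (∑ f, ∑ g, ιK f g) + ∑ f, ∑ g, w f g := rfl
  have hEn' : En n G' A' c' m' = (∑ f, (if f ∈ S then 0 else Per (W (A f)) (G f))) -
      (∑ f, ∑ g, (if f ∈ S ∨ g ∈ S then 0 else ιK f g)) +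
      ∑ f, ∑ g, (if f ∈ S ∨ g ∈ S then 0 else w f g) := by
    show (∑ f, Per (W (A' f)) (G' f)) - (∑ f, ∑ g, (if f = g then 0 else ι (W (A' f)) (G' f) (G' g))) +
      ∑ f, ∑ g, (if f = g then 0 else c' f g / 2 * ι (Dsc (m' f g)) (G' f) (G' g)) = _
    simp only [hP', hι', hw']
  have hFrS : (∑ f ∈ S, (Per (W (A f)) (G f) - ∑ g, (if f = g then 0 else ι (W (A f)) (G f) (G g)))) =
      (∑ f, (if f ∈ S then Per (W (A f)) (G f) else 0)) - ∑ f, ∑ g, (if f ∈ S then ιK f g else 0) := by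
    have e1 : (∑ f, (if f ∈ S then Per (W (A f)) (G f) else 0)) = ∑ f ∈ S, Per (W (A f)) (G f) := by
      rw [← Finset.sum_filter, Finset.filter_mem_eq_inter, Finset.univ_inter]
    have e2 : (∑ f, ∑ g, (if f ∈ S then ιK f g else 0)) = ∑ f ∈ S, ∑ g, ιK f g := by
      have h' : ∀ f, (∑ g, (if f ∈ S then ιK f g else 0)) = if f ∈ S then ∑ g, ιK f g else 0 := by
        intro f; split_ifs <;> simp
      simp_rw [h']
      rw [← Finset.sum_filter, Finset.filter_mem_eq_inter, Finset.univ_inter]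
    rw [e1, e2, ← Finset.sum_sub_distrib]
  rw [hEn, hEn', hFrS]
  -- single sums cancel exactly
  have hsingle : (∑ f, (if f ∈ S then 0 else Per (W (A f)) (G f))) +
      ∑ f, (if f ∈ S then Per (W (A f)) (G f) else 0) = ∑ f, Per (W (A f)) (G f) := by
    rw [← Finset.sum_add_distrib]
    exact Finset.sum_congr rfl fun f _ => by split_ifs <;> simp
  -- double sums: the D-inequality
  have hdouble : -(∑ f, ∑ g, (if f ∈ S ∨ g ∈ S then 0 else ιK f g)) +
      (∑ f, ∑ g, (if f ∈ S ∨ g ∈ S then 0 else w f g)) - (∑ f, ∑ g, (if f ∈ S then ιK f g else 0))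
      - (Real.sqrt 5 - 1) * (∑ f, ∑ g, (if f ∉ S ∧ g ∈ S then
          ι (Metric.closedBall (0 : EuclideanSpace ℝ (Fin 3)) 1) (G f) (G g) else 0))
      + (∑ f, ∑ g, (if f ≠ g ∧ f ∈ S ∧ g ∈ S ∧ cls f ≠ cls g
            then ι (Metric.closedBall (0 : EuclideanSpace ℝ (Fin 3)) 1) (G f) (G g) / 2 else 0)) ≤
      -(∑ f, ∑ g, ιK f g) + ∑ f, ∑ g, w f g := by
    have key : ∀ f g, -(if f ∈ S ∨ g ∈ S then 0 else ιK f g) + (if f ∈ S ∨ g ∈ S then 0 else w f g)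
        - (if f ∈ S then ιK f g else 0)
        - (Real.sqrt 5 - 1) * (if f ∉ S ∧ g ∈ S then
            ι (Metric.closedBall (0 : EuclideanSpace ℝ (Fin 3)) 1) (G f) (G g) else 0)
        + (if f ≠ g ∧ f ∈ S ∧ g ∈ S ∧ cls f ≠ cls g
            then ι (Metric.closedBall (0 : EuclideanSpace ℝ (Fin 3)) 1) (G f) (G g) / 2 else 0)
        + D f g = -ιK f g + w f g := by
      intro f g
      have hιBfg : ∀ (hfg : f ≠ g), ι (Metric.closedBall (0 : EuclideanSpace ℝ (Fin 3)) 1) (G f) (G g) = ιB f g :=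
        fun hfg => by simp [hιB, hfg]
      simp only [hD]
      by_cases hfg : f = g
      · subst hfg
        by_cases hf : f ∈ S <;> simp [hf, hιK, hw]
      by_cases hf : f ∈ S <;> by_cases hg : g ∈ S <;>
        (simp [hf, hg, hfg, hιBfg hfg]; try ring)
    have hsum : ∀ f, (∑ g, (-(if f ∈ S ∨ g ∈ S then 0 else ιK f g) + (if f ∈ S ∨ g ∈ S then 0 else w f g)
        - (if f ∈ S then ιK f g else 0)
        - (Real.sqrt 5 - 1) * (if f ∉ S ∧ g ∈ S then
            ι (Metric.closedBall (0 : EuclideanSpace ℝ (Fin 3)) 1) (G f) (G g) else 0)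
        + (if f ≠ g ∧ f ∈ S ∧ g ∈ S ∧ cls f ≠ cls g
            then ι (Metric.closedBall (0 : EuclideanSpace ℝ (Fin 3)) 1) (G f) (G g) / 2 else 0)
        + D f g)) = ∑ g, (-ιK f g + w f g) := fun f => Finset.sum_congr rfl fun g _ => key f g
    have htot := congrArg (fun F : Fin n → ℝ => ∑ f, F f) (funext hsum)
    simp only [Finset.sum_add_distrib, Finset.sum_sub_distrib, Finset.sum_neg_distrib,
      ← Finset.mul_sum] at htot
    linarith [hDsum]
  linarith [hsingle, hdouble]

end Summit.Ventures.Crystal3D.Cruxes.PolycrystalWulffBound.PolyDensity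

end
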